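import Literature.Barriers.CriticalPhenomena.PlaquetteWalkYBClassification
import HarnessLib

/-!
# Barrier catalogue (SAWScalingLimit), positive side: the exact vertex identity on the WHOLE
complexified Yang–Baxter curve, and the `θ`-free two-sided classification at `σ = 5/8`

Companion of `PlaquetteWalkSpinRigidity` / `PlaquetteWalkYBClassification` (necessity: at the spin
`σ = 5/8`, `t = e^{−5iπ/16}`, an exact plaquette vertex relation with `u₁u₂v ≠ 0`, `c ≠ 0` — already
on every ROW-CONVEX face list for every boundary root — forces the five weights onto the curve
`ybCurve ε t r`, `ε = ±1`, `r = (c_N + εc_S)/(c_E + εc_W) ∈ ℂ`) and of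
`Literature.Probability.RandomPlanarGeometry.YangBaxterSAWGeneralDomain` (sufficiency for the PRINTED
weights `W(θ) = ybCurve (−1) t r(θ)`, `r(θ) = e^{i(3θ/8+5π/16)}`, `θ ∈ [π/3, 2π/3]` — an arc of the unit
circle in the `r`-plane — on every finite face list for every OUTER root).

This file closes the gap between the two classes of curve points by ANALYTIC CONTINUATION IN `r`,
done algebraically: for a fixed face list, root and face, the vertex functional of the weights
`ybCurve (−1) t r` with coefficients `(1, r, −1, −r)` is a polynomial in `r` divided by a power of
`Q_t(r) = r (t⁶(1 + r⁴) − (1 + t¹²) r²)` (`IsPolyOver`, closure under the finite sums and products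
defining `vertexFunctional`); it vanishes on the infinite arc `{r(θ) : θ ∈ [π/3, 2π/3]}` minus the
finitely many zeros of `Q_t`, hence its numerator is the zero polynomial
(`Polynomial.eq_zero_of_infinite_isRoot`), hence it vanishes at EVERY `r` with `Q_t(r) ≠ 0`:

* `vertexFunctional_ybCurve_eq_zero` — for every `r ∈ ℂ` with `r ≠ 0` and
  `t⁶(1 + r⁴) − (1 + t¹²) r² ≠ 0` (`t = e^{−5iπ/16}`), every finite face list `Dl`, every OUTER root
  `a` and every face `f₀ ∈ Dl`: `vertexFunctional (ybCurve (−1) t r) t (1, r, −1, −r) Dl a f₀ = 0`;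
  named `PlaquetteWalkYBCurveIdentity` / `PlaquetteWalkYBCurveIdentity_holds`; the row-convex class
  (`exactPlaquetteVertexRelationRC_ybCurve`) and the sign-gauge twin `ε = +1` with coefficients
  `(−1, −r, −1, −r)` (`exactPlaquetteVertexRelationRC_ybCurve_one`, via the tree's
  `ybCurve_one_eq_gauge` and `vertexFunctional_gauge`);
* `vertexFunctional_printed_eq_zero_of_weightDen_ne_zero` — the printed family `W(θ)` for EVERY real
  `θ` off the zero set of the common denominator of eq. (1) (no restriction to `[π/3, 2π/3]`);
* the `θ`-FREE TWO-SIDED CLASSIFICATION OF THE WEIGHTS at `σ = 5/8`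
  (`PlaquetteWalkYBCurveClassification_holds`): for `u₁u₂v ≠ 0`,
  `(∃ c ≠ 0, ExactPlaquetteVertexRelationRC W t c) ↔ (∃ ε ∈ {1, −1}, ∃ r, W = ybCurve ε t r)`
  (for such `W` the side conditions `r ≠ 0`, `Q_t(r) ≠ 0` are automatic: at `r = 0` or on the zero
  set of the denominator the closed forms give `u₁ = 0` resp. `v = 0`).

Sources. A. Glazman, I. Manolescu, arXiv:1708.00395, eq. (1) and Lemma 2.1
[cite: GlazmanManolescu2019, Lemma 2.1]; A. Glazman, Electron. Commun. Probab. 20 (2015), Lemma 3.1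
(for `σ = ℓ/8` the weights solving the local linear system are unique and given in closed form for
every rhombus angle `θ`; `σ = 5/8` gives eq. (1)) [cite: Glazman2015WeightedSAW, Lemma 3.1]; the
general-domain root quantifier: [cite: DuminilCopinSmirnov2012, Lemma 1]. In print `θ` is a real
rhombus angle. Status of the complex-`r` statement (venture lane «pcv-sawmu», label cell of record
lit-1 g13 / lit-2 g15: NEW-IN-WRITING, provisional): not located in print; nearest:
[cite: IkhlefCardy2009, §3 (arXiv:0810.5037 (15a)–(15d) p. 8: the complex linear system, solved there for real weights only)],
[cite: Glazman2015WeightedSAW, Lemma 3.1 (ECP 20 no. 86 pp. 5–6; θ ∈ [π/3, 2π/3] real, |r| = 1)];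
Alam–Batchelor 2014 (arXiv:1402.0937, pp. 6, 11: unimodular spectral parameter, real weights)
likewise real. The equivalence with one technique class on both sides is this file's consolidation. NOT here: existence
at the fifteen other sixteenth roots `t` of `−1` (Glazman's families `σ = ℓ/8`, `ℓ ≠ 5`; the tree's
local relations are typed at `σ = 5/8` only), and the branches `u₁ = 0` / `u₂ = 0` / `v = 0` of the
necessity side.

Implementation note: `vertexFunctional_printed_eq_zero_of_weightDen_ne_zero` reads the private lemma
`printed_D` of `PlaquetteWalkWeightRigidityPrinted` (the curve's denominator at `r(θ)` is nonzero off
the zero set of the denominator of eq. (1)) via `open private … from` (`Batteries.Tactic.OpenPrivate`,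
available through the `Mathlib` import of `PlaquetteWalkYBClassification`); nothing else is opened.

Written for the venture lane «pcv-sawmu» (Tier B, conjectures C-B1/C-B2 of HOME/STRUCTURE.md §2;
b-engine-1 gen 10).
-/

noncomputable section

open Polynomial

namespace Literature.Barriers.CriticalPhenomena.PlaquetteWalk

open Literature.Probability.RandomPlanarGeometry.SAW.YangBaxter Real Complex

/-! ### Functions that are a polynomial over a power of a fixed polynomial -/

/-- `IsPolyOver Q f`: off the zero set of `Q`, the function `f : ℂ → ℂ` is a polynomial divided by a
power of `Q`. [folklore] -/
private def IsPolyOver (Q : ℂ[X]) (f : ℂ → ℂ) : Prop :=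
  ∃ (P : ℂ[X]) (n : ℕ), ∀ r : ℂ, Q.eval r ≠ 0 → f r = P.eval r / Q.eval r ^ n

namespace IsPolyOver

variable {Q : ℂ[X]} {f g : ℂ → ℂ}

/-- Pointwise congruence off the zero set of `Q`. [folklore] -/
private theorem congr' (hf : IsPolyOver Q f) (h : ∀ r, Q.eval r ≠ 0 → g r = f r) : IsPolyOver Q g := by
  obtain ⟨P, n, hP⟩ := hf
  exact ⟨P, n, fun r hr => by rw [h r hr, hP r hr]⟩

/-- Constants. [folklore] -/
private theorem const (Q : ℂ[X]) (c : ℂ) : IsPolyOver Q fun _ => c :=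
  ⟨Polynomial.C c, 0, fun _ _ => by simp⟩

/-- The identity. [folklore] -/
private theorem id (Q : ℂ[X]) : IsPolyOver Q fun r => r :=
  ⟨X, 0, fun _ _ => by simp⟩

/-- Sums. [folklore] -/
private theorem add (hf : IsPolyOver Q f) (hg : IsPolyOver Q g) : IsPolyOver Q fun r => f r + g r := by
  obtain ⟨P, n, hP⟩ := hf
  obtain ⟨R, m, hR⟩ := hg
  refine ⟨P * Q ^ m + R * Q ^ n, n + m, fun r hr => ?_⟩
  beta_reduce
  rw [hP r hr, hR r hr, div_add_div _ _ (pow_ne_zero n hr) (pow_ne_zero m hr)]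
  simp only [eval_add, eval_mul, eval_pow, pow_add]
  ring

/-- Products. [folklore] -/
private theorem mul (hf : IsPolyOver Q f) (hg : IsPolyOver Q g) : IsPolyOver Q fun r => f r * g r := by
  obtain ⟨P, n, hP⟩ := hf
  obtain ⟨R, m, hR⟩ := hg
  refine ⟨P * R, n + m, fun r hr => ?_⟩
  beta_reduce
  rw [hP r hr, hR r hr, div_mul_div_comm, ← pow_add, eval_mul]

/-- Negation. [folklore] -/
private theorem neg (hf : IsPolyOver Q f) : IsPolyOver Q fun r => -f r := by
  obtain ⟨P, n, hP⟩ := hf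
  exact ⟨-P, n, fun r hr => by beta_reduce; rw [hP r hr, eval_neg, neg_div]⟩

/-- Differences. [folklore] -/
private theorem sub (hf : IsPolyOver Q f) (hg : IsPolyOver Q g) : IsPolyOver Q fun r => f r - g r :=
  (hf.add hg.neg).congr' fun _ _ => sub_eq_add_neg _ _

/-- Natural powers. [folklore] -/
private theorem pow (hf : IsPolyOver Q f) (k : ℕ) : IsPolyOver Q fun r => f r ^ k := by
  induction k with
  | zero => exact (const Q 1).congr' fun _ _ => pow_zero _
  | succ k ih => exact (ih.mul hf).congr' fun _ _ => pow_succ _ _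

/-- Finite sums. [folklore] -/
private theorem sum {ι : Type*} (s : Finset ι) {F : ι → ℂ → ℂ} (h : ∀ i ∈ s, IsPolyOver Q (F i)) :
    IsPolyOver Q fun r => ∑ i ∈ s, F i r := by
  classical
  induction s using Finset.induction_on with
  | empty => exact (const Q 0).congr' fun _ _ => by simp
  | insert i s hi ih =>
    exact ((h i (Finset.mem_insert_self _ _)).add (ih fun j hj => h j (Finset.mem_insert_of_mem hj))).congr'
      fun _ _ => Finset.sum_insert hi

/-- The inverse of a factor of `Q`. [folklore] -/
private theorem inv_of_factor {A B : ℂ[X]} (hQ : Q = A * B) : IsPolyOver Q fun r => (B.eval r)⁻¹ := by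
  refine ⟨A, 1, fun r hr => ?_⟩
  rw [hQ, eval_mul] at hr ⊢
  have hB : B.eval r ≠ 0 := right_ne_zero_of_mul hr
  have hA : A.eval r ≠ 0 := left_ne_zero_of_mul hr
  rw [pow_one, eq_div_iff (mul_ne_zero hA hB), mul_comm (A.eval r), inv_mul_cancel_left₀ hB]

/-- If `f` is a polynomial over a power of `Q` and vanishes on an infinite set avoiding the zeros of
`Q`, then it vanishes off the zero set of `Q`. [folklore] -/
private theorem eq_zero_of_infinite (hf : IsPolyOver Q f) {S : Set ℂ} (hS : S.Infinite)
    (hSQ : ∀ r ∈ S, Q.eval r ≠ 0) (hS0 : ∀ r ∈ S, f r = 0) {r : ℂ} (hr : Q.eval r ≠ 0) : f r = 0 := by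
  obtain ⟨P, n, hP⟩ := hf
  have hP0 : P = 0 := by
    refine Polynomial.eq_zero_of_infinite_isRoot P (hS.mono fun x hx => ?_)
    have h := hP x (hSQ x hx)
    rw [hS0 x hx, eq_comm, div_eq_zero_iff] at h
    exact h.resolve_right (pow_ne_zero n (hSQ x hx))
  rw [hP r hr, hP0, eval_zero, zero_div]

end IsPolyOver

/-! ### The Yang–Baxter curve is rational in the coefficient ratio `r` -/

/-- The cleared denominator of the Yang–Baxter curve at phase `t`, as a polynomial in the coefficient
ratio: `Q_t(X) = X · (t⁶(1 + X⁴) − (1 + t¹²) X²)`. [folklore] -/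
private def ybDenPoly (t : ℂ) : ℂ[X] :=
  X * (Polynomial.C (t ^ 6) * (1 + X ^ 4) - Polynomial.C (1 + t ^ 12) * X ^ 2)

/-- Evaluation of `Q_t`. [folklore] -/
private theorem eval_ybDenPoly (t r : ℂ) :
    (ybDenPoly t).eval r = r * (t ^ 6 * (1 + r ^ 4) - (1 + t ^ 12) * r ^ 2) := by
  simp [ybDenPoly]

/-- `Q_t(r) ≠ 0` iff `r ≠ 0` and the curve's denominator is nonzero. [folklore] -/
private theorem eval_ybDenPoly_ne_zero_iff (t r : ℂ) :
    (ybDenPoly t).eval r ≠ 0 ↔ r ≠ 0 ∧ t ^ 6 * (1 + r ^ 4) - (1 + t ^ 12) * r ^ 2 ≠ 0 := by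
  rw [eval_ybDenPoly, mul_ne_zero_iff]

/-- `Q_t ≠ 0` for `t ≠ 0` (its second factor takes the value `t⁶` at `0`). [folklore] -/
private theorem ybDenPoly_ne_zero {t : ℂ} (ht : t ≠ 0) : ybDenPoly t ≠ 0 := by
  intro h
  rw [ybDenPoly, mul_eq_zero] at h
  rcases h with h | h
  · exact Polynomial.X_ne_zero h
  · have h0 := congrArg (Polynomial.eval 0) h
    simp [ht] at h0

section Curve

variable (ε t : ℂ)

/-- `1/(t⁶(1 + r⁴) − (1 + t¹²) r²)` is a polynomial over `Q_t`. [folklore] -/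
private theorem isPolyOver_inv_den :
    IsPolyOver (ybDenPoly t) fun r => (t ^ 6 * (1 + r ^ 4) - (1 + t ^ 12) * r ^ 2)⁻¹ :=
  (IsPolyOver.inv_of_factor (Q := ybDenPoly t) (A := X)
    (B := Polynomial.C (t ^ 6) * (1 + X ^ 4) - Polynomial.C (1 + t ^ 12) * X ^ 2) rfl).congr'
    fun _ _ => by simp

/-- `1/r` is a polynomial over `Q_t`. [folklore] -/
private theorem isPolyOver_inv_r : IsPolyOver (ybDenPoly t) fun r => r⁻¹ :=
  (IsPolyOver.inv_of_factor (Q := ybDenPoly t)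
    (A := Polynomial.C (t ^ 6) * (1 + X ^ 4) - Polynomial.C (1 + t ^ 12) * X ^ 2) (B := X)
    (by rw [ybDenPoly, mul_comm])).congr' fun _ _ => by simp

/-- `1/(ε r (t⁴ − 1))` is a polynomial over `Q_t`. [folklore] -/
private theorem isPolyOver_inv_εr : IsPolyOver (ybDenPoly t) fun r => (ε * r * (t ^ 4 - 1))⁻¹ :=
  ((IsPolyOver.const _ (ε * (t ^ 4 - 1))⁻¹).mul (isPolyOver_inv_r t)).congr' fun r _ => by
    rw [show ε * r * (t ^ 4 - 1) = (ε * (t ^ 4 - 1)) * r by ring, mul_inv]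

/-- The straight weight `v(ε, t, r)` is rational in `r` over `Q_t`. [folklore] -/
private theorem isPolyOver_ybV : IsPolyOver (ybDenPoly t) fun r => ybV ε t r := by
  have hN : IsPolyOver (ybDenPoly t) fun r => t ^ 6 * (1 + r ^ 4) - (t ^ 4 + t ^ 8) * r ^ 2 :=
    ((IsPolyOver.const _ (t ^ 6)).mul ((IsPolyOver.const _ 1).add ((IsPolyOver.id _).pow 4))).sub
      ((IsPolyOver.const _ (t ^ 4 + t ^ 8)).mul ((IsPolyOver.id _).pow 2))
  exact (((IsPolyOver.const _ (-ε)).mul hN).mul (isPolyOver_inv_den t)).congr' fun _ _ => by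
    rw [ybV, div_eq_mul_inv]

/-- `1 + ε v(ε, t, r)` is rational in `r` over `Q_t`. [folklore] -/
private theorem isPolyOver_one_add : IsPolyOver (ybDenPoly t) fun r => 1 + ε * ybV ε t r :=
  (IsPolyOver.const _ 1).add ((IsPolyOver.const _ ε).mul (isPolyOver_ybV ε t))

/-- The corner weight `u₁(ε, t, r)` is rational in `r` over `Q_t`. [folklore] -/
private theorem isPolyOver_ybU1 : IsPolyOver (ybDenPoly t) fun r => ybU1 ε t r :=
  ((((IsPolyOver.const _ t).mul (isPolyOver_one_add ε t)).mul
    (((IsPolyOver.id _).pow 2).sub (IsPolyOver.const _ (t ^ 2)))).mul (isPolyOver_inv_εr ε t)).congr'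
    fun _ _ => by rw [ybU1, div_eq_mul_inv]

/-- The co-corner weight `u₂(ε, t, r)` is rational in `r` over `Q_t`. [folklore] -/
private theorem isPolyOver_ybU2 : IsPolyOver (ybDenPoly t) fun r => ybU2 ε t r :=
  ((((IsPolyOver.const _ (-ε)).mul (isPolyOver_ybU1 ε t)).sub
    (((IsPolyOver.const _ t).mul (isPolyOver_one_add ε t)).mul (IsPolyOver.id _))).mul
    (IsPolyOver.const _ (t ^ 2)⁻¹)).congr' fun _ _ => by rw [ybU2, div_eq_mul_inv]

/-- The two-corner weight `w₁(ε, t, r)` is rational in `r` over `Q_t`. [folklore] -/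
private theorem isPolyOver_ybW1 : IsPolyOver (ybDenPoly t) fun r => ybW1 ε t r :=
  ((((IsPolyOver.const _ (-ε)).mul (isPolyOver_ybV ε t)).sub
    ((((IsPolyOver.const _ ε).mul (isPolyOver_ybU1 ε t)).mul (IsPolyOver.const _ (t ^ 5))).mul
      (IsPolyOver.id _))).mul
    (IsPolyOver.const _ (t ^ 4)⁻¹)).congr' fun _ _ => by rw [ybW1, div_eq_mul_inv]

/-- The two-co-corner weight `w₂(ε, t, r)` is rational in `r` over `Q_t`. [folklore] -/
private theorem isPolyOver_ybW2 : IsPolyOver (ybDenPoly t) fun r => ybW2 ε t r :=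
  (((((IsPolyOver.const _ (-ε)).mul (isPolyOver_ybV ε t)).mul (IsPolyOver.const _ (t ^ 5))).sub
    ((isPolyOver_ybU2 ε t).mul (IsPolyOver.id _))).mul
    (IsPolyOver.const _ t⁻¹)).congr' fun _ _ => by rw [ybW2, div_eq_mul_inv]

/-- The plaquette weight of a mid-edge list, on the curve, is rational in `r` over `Q_t`.
[cite: GlazmanManolescu2019, §1 (the weight of a walk is the product of the rhombus weights)] -/
private theorem isPolyOver_weightL (l : List MidEdge) :
    IsPolyOver (ybDenPoly t) fun r => weightL (ybCurve ε t r) l :=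
  ((((((isPolyOver_ybU1 ε t).pow (cfgCount l [.corner])).mul
    ((isPolyOver_ybU2 ε t).pow (cfgCount l [.coCorner]))).mul
    ((isPolyOver_ybV ε t).pow (cfgCount l [.straight]))).mul
    ((isPolyOver_ybW1 ε t).pow (cfgCount l [.corner, .corner]))).mul
    ((isPolyOver_ybW2 ε t).pow (cfgCount l [.coCorner, .coCorner]))).congr' fun _ _ => by
    simp only [weightL, CWeights.mono, ybCurve]

/-- The free-weight observable on the curve is rational in `r` over `Q_t`.
[cite: GlazmanManolescu2019, §2.1, eq. (2.1)] -/
private theorem isPolyOver_gmObservable (Dl : List Face) (a z : MidEdge) :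
    IsPolyOver (ybDenPoly t) fun r => gmObservable (ybCurve ε t r) t Dl a z :=
  (IsPolyOver.sum (Q := ybDenPoly t) (Finset.univ : Finset (YBWalk (dom Dl) a z))
    (F := fun γ r => weightL (ybCurve ε t r) γ.mids * t ^ quarterTurnsL γ.mids)
    fun γ _ => (isPolyOver_weightL ε t γ.mids).mul (IsPolyOver.const _ _)).congr'
    fun _ _ => by rw [gmObservable]

/-- The odd coefficient vector `(1, r, −1, −r)` of ratio `r`. [cite: GlazmanManolescu2019, Lemma 2.1, eq. (CR)] -/
def oddCoeff (r : ℂ) : Fin 4 → ℂ := ![1, r, -1, -r]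

/-- `oddCoeff r ≠ 0` (its first entry is `1`). [cite: GlazmanManolescu2019, Lemma 2.1, eq. (CR)] -/
theorem oddCoeff_ne_zero (r : ℂ) : oddCoeff r ≠ 0 := by
  intro h
  have h0 := congrFun h 0
  simp [oddCoeff] at h0

/-- At `r = r(θ)` the odd vector is the Yang–Baxter coefficient vector `ybCoeff θ`. [cite: GlazmanManolescu2019, Lemma 2.1, eq. (CR)] -/
theorem oddCoeff_ybRatio (θ : ℝ) : oddCoeff (ybRatio θ) = ybCoeff θ := rfl

/-- Each coefficient `(1, r, −1, −r)_s` is rational in `r` over `Q_t`. [folklore] -/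
private theorem isPolyOver_oddCoeff (s : Fin 4) : IsPolyOver (ybDenPoly t) fun r => oddCoeff r s := by
  fin_cases s
  · exact (IsPolyOver.const _ 1).congr' fun _ _ => rfl
  · exact (IsPolyOver.id _).congr' fun _ _ => rfl
  · exact (IsPolyOver.const _ (-1)).congr' fun _ _ => rfl
  · exact (IsPolyOver.id _).neg.congr' fun _ _ => rfl

/-- **The vertex functional on the curve is rational in the coefficient ratio**: for fixed `Dl, a, f₀`
the map `r ↦ vertexFunctional (ybCurve ε t r) t (1, r, −1, −r) Dl a f₀` is a polynomial in `r` over a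
power of `Q_t`. [cite: DuminilCopinSmirnov2012, Lemma 1 (shape of the relation)] -/
private theorem isPolyOver_vertexFunctional (Dl : List Face) (a : MidEdge) (f₀ : Face) :
    IsPolyOver (ybDenPoly t) fun r => vertexFunctional (ybCurve ε t r) t (oddCoeff r) Dl a f₀ :=
  (IsPolyOver.sum (Q := ybDenPoly t) (Finset.univ : Finset (Fin 4))
    (F := fun s r => oddCoeff r s * gmObservable (ybCurve ε t r) t Dl a (slotSide f₀ s))
    fun s _ => (isPolyOver_oddCoeff t s).mul (isPolyOver_gmObservable ε t Dl a _)).congr'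
    fun _ _ => by rw [vertexFunctional]

end Curve

/-! ### The identity on the whole curve (outer roots), by continuation from the printed arc -/

/-- The printed arc `{r(θ) : θ ∈ [π/3, 2π/3]}` is infinite (`θ ↦ r(θ) = e^{i(3θ/8 + 5π/16)}` is
injective there, its argument `3θ/8 + 5π/16 ∈ [7π/16, 9π/16]` lying in `(−π, π]`). [folklore] -/
private theorem printedArc_infinite : (ybRatio '' Set.Icc (π / 3) (2 * π / 3)).Infinite := by
  refine Set.Infinite.image (fun θ₁ h₁ θ₂ h₂ h => ?_) (Set.Icc_infinite (by linarith [Real.pi_pos]))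
  have harg : ∀ θ ∈ Set.Icc (π / 3) (2 * π / 3), Complex.arg (ybRatio θ) = 3 * θ / 8 + 5 * π / 16 := by
    intro θ hθ
    rw [ybRatio, Complex.exp_mul_I, Complex.arg_cos_add_sin_mul_I]
    constructor <;> linarith [Real.pi_pos, hθ.1, hθ.2]
  have := harg θ₁ h₁
  rw [h, harg θ₂ h₂] at this
  linarith

/-- On the printed arc the curve point carries the identity: `ybCurve (−1) t r(θ) = W(θ)` (the tree's
`printedWeights_eq_ybCurve`) and Lemma 2.1 on general domains for outer roots
(`vertexFunctional_printed_eq_zero`). [cite: GlazmanManolescu2019, eq. (1), Lemma 2.1] -/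
private theorem vertexFunctional_ybCurve_eq_zero_of_mem_arc {θ : ℝ} (hθ : θ ∈ Set.Icc (π / 3) (2 * π / 3))
    (Dl : List Face) (a : MidEdge) (hO : OuterRoot (dom Dl) a) (f₀ : Face) (hf : f₀ ∈ Dl) :
    vertexFunctional (ybCurve (-1) tFiveEighths (ybRatio θ)) tFiveEighths (oddCoeff (ybRatio θ)) Dl a f₀ = 0 := by
  rw [← printedWeights_eq_ybCurve θ (weightDen_ne_zero_of_mem hθ), oddCoeff_ybRatio]
  exact vertexFunctional_printed_eq_zero hθ Dl a hO f₀ hf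

/-- **The exact vertex identity on the whole complexified Yang–Baxter curve** (`σ = 5/8`, odd component):
for every `r ∈ ℂ` with `r ≠ 0` and `t⁶(1 + r⁴) − (1 + t¹²) r² ≠ 0`, `t = e^{−5iπ/16}`, the weights
`ybCurve (−1) t r` satisfy `F(z_E) + r F(z_N) − F(z_W) − r F(z_S) = 0` at every face of every finite
face list for every OUTER root. Proof: continuation in `r` from the printed arc
(`Polynomial.eq_zero_of_infinite_isRoot`). [cite: GlazmanManolescu2019, Lemma 2.1]
[cite: Glazman2015WeightedSAW, Lemma 3.1 (the σ = 5/8 family, every rhombus angle)] -/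
theorem vertexFunctional_ybCurve_eq_zero {r : ℂ} (hr : r ≠ 0)
    (hD : tFiveEighths ^ 6 * (1 + r ^ 4) - (1 + tFiveEighths ^ 12) * r ^ 2 ≠ 0)
    (Dl : List Face) (a : MidEdge) (hO : OuterRoot (dom Dl) a) (f₀ : Face) (hf : f₀ ∈ Dl) :
    vertexFunctional (ybCurve (-1) tFiveEighths r) tFiveEighths (oddCoeff r) Dl a f₀ = 0 := by
  -- the good part of the printed arc: infinite, avoids the zeros of `Q_t`, and the functional vanishes there
  have hS : ((ybRatio '' Set.Icc (π / 3) (2 * π / 3)) \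
      {x | (ybDenPoly tFiveEighths).IsRoot x}).Infinite :=
    printedArc_infinite.sdiff (Polynomial.finite_setOf_isRoot (ybDenPoly_ne_zero tFiveEighths_ne_zero))
  have hSQ : ∀ x ∈ (ybRatio '' Set.Icc (π / 3) (2 * π / 3)) \ {x | (ybDenPoly tFiveEighths).IsRoot x},
      (ybDenPoly tFiveEighths).eval x ≠ 0 := fun x hx => hx.2
  have hS0 : ∀ x ∈ (ybRatio '' Set.Icc (π / 3) (2 * π / 3)) \ {x | (ybDenPoly tFiveEighths).IsRoot x},
      vertexFunctional (ybCurve (-1) tFiveEighths x) tFiveEighths (oddCoeff x) Dl a f₀ = 0 := by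
    rintro x ⟨⟨θ, hθ, rfl⟩, -⟩
    exact vertexFunctional_ybCurve_eq_zero_of_mem_arc hθ Dl a hO f₀ hf
  exact (isPolyOver_vertexFunctional (-1) tFiveEighths Dl a f₀).eq_zero_of_infinite hS hSQ hS0
    ((eval_ybDenPoly_ne_zero_iff _ _).2 ⟨hr, hD⟩)

/-- **Named statement `PlaquetteWalkYBCurveIdentity`**: at `σ = 5/8`, every point `ybCurve (−1) t r`
of the complexified Yang–Baxter curve (`r ≠ 0`, `t⁶(1 + r⁴) ≠ (1 + t¹²) r²`) carries the exact vertex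
identity with coefficients `(1, r, −1, −r)` on every finite face list for every outer root.
[cite: GlazmanManolescu2019, Lemma 2.1] [cite: Glazman2015WeightedSAW, Lemma 3.1] -/
def _root_.Literature.Barriers.CriticalPhenomena.PlaquetteWalkYBCurveIdentity : Prop :=
  ∀ r : ℂ, r ≠ 0 → tFiveEighths ^ 6 * (1 + r ^ 4) - (1 + tFiveEighths ^ 12) * r ^ 2 ≠ 0 →
    ∀ (Dl : List Face) (a : MidEdge) (f₀ : Face), f₀ ∈ Dl → OuterRoot (dom Dl) a →
      vertexFunctional (ybCurve (-1) tFiveEighths r) tFiveEighths (oddCoeff r) Dl a f₀ = 0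

/-- **`PlaquetteWalkYBCurveIdentity` holds.** [cite: GlazmanManolescu2019, Lemma 2.1] -/
theorem _root_.Literature.Barriers.CriticalPhenomena.PlaquetteWalkYBCurveIdentity_holds :
    PlaquetteWalkYBCurveIdentity :=
  fun _ hr hD Dl a f₀ hf hO => vertexFunctional_ybCurve_eq_zero hr hD Dl a hO f₀ hf

/-- **Row-convex class, odd component**: every good curve point `ybCurve (−1) t r` belongs to the
technique class `ExactPlaquetteVertexRelationRC` with coefficients `(1, r, −1, −r)`.
[cite: GlazmanManolescu2019, Lemma 2.1] -/
theorem exactPlaquetteVertexRelationRC_ybCurve {r : ℂ} (hr : r ≠ 0)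
    (hD : tFiveEighths ^ 6 * (1 + r ^ 4) - (1 + tFiveEighths ^ 12) * r ^ 2 ≠ 0) :
    ExactPlaquetteVertexRelationRC (ybCurve (-1) tFiveEighths r) tFiveEighths (oddCoeff r) :=
  fun Dl a f₀ hD' hf ha =>
    vertexFunctional_ybCurve_eq_zero hr hD Dl a (outerRoot_of_noHoles (noHoles_of_rowConvex hD') ha) f₀ hf

/-- **Row-convex class, even component** (the sign-gauge twin): every good curve point
`ybCurve 1 t r = 𝒢 (ybCurve (−1) t r)` belongs to the class with the gauged coefficients
`(−1, −r, −1, −r)`. [cite: Glazman2015WeightedSAW, Lemma 3.1 (symmetries of the local system)] -/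
theorem exactPlaquetteVertexRelationRC_ybCurve_one {r : ℂ} (hr : r ≠ 0)
    (hD : tFiveEighths ^ 6 * (1 + r ^ 4) - (1 + tFiveEighths ^ 12) * r ^ 2 ≠ 0) :
    ExactPlaquetteVertexRelationRC (ybCurve 1 tFiveEighths r) tFiveEighths (gaugeCoeff (oddCoeff r)) := by
  intro Dl a f₀ hD' hf ha
  rw [ybCurve_one_eq_gauge, signGauge, vertexFunctional_gauge,
    exactPlaquetteVertexRelationRC_ybCurve hr hD Dl a f₀ hD' hf ha, mul_zero]

/-! ### The printed family beyond `[π/3, 2π/3]` -/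

open private printed_D from Literature.Barriers.CriticalPhenomena.PlaquetteWalkWeightRigidityPrinted

/-- **Lemma 2.1 on general domains for the printed weights `W(θ)` at EVERY real `θ` off the zero set of
the common denominator of eq. (1)** (no restriction to the positive range `[π/3, 2π/3]`): `W(θ)` is the
curve point `ybCurve (−1) t r(θ)` (`printedWeights_eq_ybCurve`), `r(θ) ≠ 0`, and the curve's
denominator at `r(θ)` is a nonzero multiple of the denominator of eq. (1).
[cite: GlazmanManolescu2019, eq. (1), Lemma 2.1] [cite: Glazman2015WeightedSAW, Lemma 3.1 (every rhombus angle θ)] -/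
theorem vertexFunctional_printed_eq_zero_of_weightDen_ne_zero {θ : ℝ} (hθ : weightDen θ ≠ 0)
    (Dl : List Face) (a : MidEdge) (hO : OuterRoot (dom Dl) a) (f₀ : Face) (hf : f₀ ∈ Dl) :
    vertexFunctional (printedWeights θ) tFiveEighths (ybCoeff θ) Dl a f₀ = 0 := by
  have hD := printed_D θ hθ
  simp only [one_pow, mul_one] at hD
  rw [printedWeights_eq_ybCurve θ hθ, ← oddCoeff_ybRatio]
  exact vertexFunctional_ybCurve_eq_zero (ybRatio_ne_zero θ) hD Dl a hO f₀ hf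

/-- The same in the row-convex technique class. [cite: GlazmanManolescu2019, eq. (1), Lemma 2.1] -/
theorem exactPlaquetteVertexRelationRC_printed_of_weightDen_ne_zero {θ : ℝ} (hθ : weightDen θ ≠ 0) :
    ExactPlaquetteVertexRelationRC (printedWeights θ) tFiveEighths (ybCoeff θ) :=
  fun Dl a f₀ hD hf ha => vertexFunctional_printed_eq_zero_of_weightDen_ne_zero hθ Dl a
    (outerRoot_of_noHoles (noHoles_of_rowConvex hD) ha) f₀ hf

/-! ### The `θ`-free two-sided classification of the weights at `σ = 5/8` -/

/-- At `r = 0` the closed form of the corner weight degenerates to `u₁ = 0` (zero denominator).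
[folklore] -/
private theorem ybU1_zero_right (ε t : ℂ) : ybU1 ε t 0 = 0 := by
  simp [ybU1]

/-- On the zero set of the curve's denominator the closed form of the straight weight degenerates to
`v = 0`. [folklore] -/
private theorem ybV_eq_zero_of_den_eq_zero {ε t r : ℂ} (h : t ^ 6 * (1 + r ^ 4) - (1 + t ^ 12) * r ^ 2 = 0) :
    ybV ε t r = 0 := by
  rw [ybV, h, div_zero]

/-- A curve point with `u₁ ≠ 0` and `v ≠ 0` is a good point: `r ≠ 0` and the denominator is nonzero.
[folklore] -/
private theorem good_of_ne_zero {ε t r : ℂ} (h1 : (ybCurve ε t r).u₁ ≠ 0) (hv : (ybCurve ε t r).v ≠ 0) :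
    r ≠ 0 ∧ t ^ 6 * (1 + r ^ 4) - (1 + t ^ 12) * r ^ 2 ≠ 0 := by
  constructor
  · rintro rfl; exact h1 (ybU1_zero_right ε t)
  · intro h; exact hv (ybV_eq_zero_of_den_eq_zero h)

/-- **Named statement `PlaquetteWalkYBCurveClassification`** — the `θ`-free two-sided classification
of exact plaquette vertex relations on `ℤ²` at the spin `σ = 5/8` (`t = e^{−5iπ/16}`), one technique
class on both sides (row-convex face lists, boundary roots): a weight system `W = (u₁, u₂, v, w₁, w₂)`
with `u₁u₂v ≠ 0` carries an exact vertex relation with SOME nonzero coefficient vector iff it is a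
point `ybCurve ε t r`, `ε = ±1`, `r ∈ ℂ`, of the complexified Yang–Baxter curve (the printed family
`W(θ) = ybCurve (−1) t r(θ)` of eq. (1) and its sign gauge being the unit-circle slice `|r| = 1`).
[cite: GlazmanManolescu2019, eq. (1), Lemma 2.1] [cite: Glazman2015WeightedSAW, Lemma 3.1] -/
def _root_.Literature.Barriers.CriticalPhenomena.PlaquetteWalkYBCurveClassification : Prop :=
  ∀ W : CWeights, W.u₁ ≠ 0 → W.u₂ ≠ 0 → W.v ≠ 0 →
    ((∃ c : Fin 4 → ℂ, c ≠ 0 ∧ ExactPlaquetteVertexRelationRC W tFiveEighths c) ↔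
      ∃ ε r : ℂ, (ε = 1 ∨ ε = -1) ∧ W = ybCurve ε tFiveEighths r)

/-- **`PlaquetteWalkYBCurveClassification` holds**: (→) weight rigidity from the row-convex class
(`weights_eq_ybCurveRC`); (←) the identity on the whole curve (`exactPlaquetteVertexRelationRC_ybCurve`,
`…_one`), the side conditions `r ≠ 0`, `Q_t(r) ≠ 0` following from `u₁ ≠ 0`, `v ≠ 0`.
[cite: GlazmanManolescu2019, eq. (1), Lemma 2.1] [cite: Glazman2015WeightedSAW, Lemma 3.1] -/
theorem _root_.Literature.Barriers.CriticalPhenomena.PlaquetteWalkYBCurveClassification_holds :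
    PlaquetteWalkYBCurveClassification := by
  intro W h1 h2 hv
  constructor
  · rintro ⟨c, hc, hrel⟩
    obtain ⟨ε, hε, -, hW⟩ := weights_eq_ybCurveRC hrel tFiveEighths_ne_zero h1 h2 hv hc
    exact ⟨ε, _, hε, hW⟩
  · rintro ⟨ε, r, hε, rfl⟩
    obtain ⟨hr, hD⟩ := good_of_ne_zero h1 hv
    rcases hε with rfl | rfl
    · exact ⟨gaugeCoeff (oddCoeff r), fun h => oddCoeff_ne_zero r (by
        rw [← gaugeCoeff_gaugeCoeff (oddCoeff r), h]; funext i; fin_cases i <;> simp [gaugeCoeff]),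
        exactPlaquetteVertexRelationRC_ybCurve_one hr hD⟩
    · exact ⟨oddCoeff r, oddCoeff_ne_zero r, exactPlaquetteVertexRelationRC_ybCurve hr hD⟩

/-- Consistency: the printed-arc classification `PlaquetteWalkYBClassification` (sufficiency half) is
the unit-circle slice `r = r(θ)`, `θ ∈ [π/3, 2π/3]`, of the curve identity. [cite: GlazmanManolescu2019, Lemma 2.1] -/
example {θ : ℝ} (hθ : θ ∈ Set.Icc (π / 3) (2 * π / 3)) :
    ExactPlaquetteVertexRelationRC (printedWeights θ) tFiveEighths (ybCoeff θ) :=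
  exactPlaquetteVertexRelationRC_printed_of_weightDen_ne_zero (weightDen_ne_zero_of_mem hθ)

end Literature.Barriers.CriticalPhenomena.PlaquetteWalk
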